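import Mathlib
import Summits.NavierStokesRegularity.NavierStokesRegularity.Theorems.SubOnsagerCeilingKPRelabel
import Summits.NavierStokesRegularity.NavierStokesRegularity.Theorems.SubOnsagerCeilingGapArchitectures4
import Summits.NavierStokesRegularity.NavierStokesRegularity.Theorems.SubOnsagerCeilingKPAsymmetricTwoCycle
import Summits.NavierStokesRegularity.NavierStokesRegularity.Theorems.SubOnsagerCeilingKPSideBranchClassCeiling
import HarnessLib

/-!
# The architecture corners at every placement of their components
# (helper file for the crux `SubOnsagerCeiling.ForwardTailCeilingKP`, stmt-NavierStokesRegularity-27057, `--supports`)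

Uses of the relabeling covariance `Theorems/SubOnsagerCeilingKPRelabel.lean`: the landed one-placement corners of the
LEAD skeleton `Cruxes/ForwardTailCeilingKP/Lines/kp_shell_barrier.lean` (registered stubs `stub_primaryGradedLargeRatio`
/ `stub_primaryGradedSmallRatio`) hold for EVERY placement `σ : Equiv.Perm (Fin 4)` of their architecture on the four
components (`β i₁ i₂ i₃ μ = T (σ i₁) (σ i₂) (σ i₃) μ` for the architecture's table `T`):

* `kpRelabel_fan_ceilingAt` — the uniform KP FAN `kpFanTable w` (hub on component `σ⁻¹ 0`) at every `ε₀ ∈ [9/25, 1]`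
  (RUNG 7, `kpFanGap10Wide_ceilingAt`);
* `kpRelabel_twoCycle_ceilingAt` — the uniform re-entry pair `kpTwoCycleTable c c` on the components `σ⁻¹ 0, σ⁻¹ 1`
  at every `ε₀ ∈ [9/25, 1]` (RUNG 8, `kpTwoCycleGap10Wide_ceilingAt`);
* `kpRelabel_twoCycleAsym_ceilingAt` — the ASYMMETRIC re-entry pair `kpTwoCycleTable c₀ c₁` inside its window on any
  two components (`kpTwoCycleAsym_ceilingAt`, leafhand g0);
* `kpRelabel_sideClass_fwdCeilingKP` — the SIDE-BRANCH CLASS (chain `c₀` on `σ⁻¹ 0`, in-shell pump `P` into `σ⁻¹ 1`,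
  exit feed `f` into the dead-end pocket `σ⁻¹ 2`) at every `b ∈ [1.9, 2]` in the certified weight range: the
  per-table body `FwdCeilingKPAt R ε₀ β` of the crux (RUNG 5, `sideClass_fwdCeilingKP`).

HONEST FRAMING: bookkeeping about Tao-type MODEL lattice ODEs (route SubOnsagerCeiling, rung TL-M2Break); widens proved
corners by placement only; no stub, crux or summit is proved and nothing here bears on Navier–Stokes regularity.
[cite: Tao2016AveragedNS, §4 (4.2)–(4.3), (4.13)] [cite: BarbatoMorandinRomito2011, §3.2]
-/

noncomputable section

-- the sub-problem namespace `NavierStokesRegularity.NavierStokesRegularity` is the tree's layout (D-0017)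
set_option linter.dupNamespace false

namespace Summit.NavierStokesRegularity.NavierStokesRegularity.Theorems

open Set Finset
open Literature.Analysis.FluidPDE.TaoCascade
open Summit.NavierStokesRegularity.NavierStokesRegularity.Theorems.SubOnsagerCeiling

variable {β : Fin 4 → Fin 4 → Fin 4 → ℤ × ℤ × ℤ → ℝ} (σ : Equiv.Perm (Fin 4))

/-- **The uniform KP fan at any placement**: `CeilingAt R ε₀ β` for `β = kpFanTable w ∘ σ` at every `ε₀ ∈ [9/25, 1]`.
[cite: Tao2016AveragedNS, §4 (4.13)] -/
theorem kpRelabel_fan_ceilingAt (w : Fin 4 → ℝ)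
    (hβ : ∀ i₁ i₂ i₃ μ, β i₁ i₂ i₃ μ = kpFanTable w (σ i₁) (σ i₂) (σ i₃) μ) :
    ∀ R : ℝ, ∀ ε₀ : ℝ, (9 : ℝ) / 25 ≤ ε₀ → ε₀ ≤ 1 → CeilingAt R ε₀ β :=
  fun R ε₀ h1 h2 => kpRelabel_ceilingAt σ hβ (kpFanGap10Wide_ceilingAt w R ε₀ h1 h2)

/-- **The uniform re-entry pair at any placement**: `CeilingAt R ε₀ β` for `β = kpTwoCycleTable c c ∘ σ`, `c > 0`, at
every `ε₀ ∈ [9/25, 1]`. [cite: Tao2016AveragedNS, §4 (4.13)] -/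
theorem kpRelabel_twoCycle_ceilingAt {c : ℝ} (hc : 0 < c)
    (hβ : ∀ i₁ i₂ i₃ μ, β i₁ i₂ i₃ μ = kpTwoCycleTable c c (σ i₁) (σ i₂) (σ i₃) μ) :
    ∀ R : ℝ, ∀ ε₀ : ℝ, (9 : ℝ) / 25 ≤ ε₀ → ε₀ ≤ 1 → CeilingAt R ε₀ β :=
  fun R ε₀ h1 h2 => kpRelabel_ceilingAt σ hβ (kpTwoCycleGap10Wide_ceilingAt hc R ε₀ h1 h2)

/-- **The asymmetric re-entry pair at any placement**, inside the window of `kpTwoCycleAsym_ceilingAt`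
(`p = b^{5/2}/(b^θ)³ ≥ 42/25`, `p²c₀²b^θ ≤ c₁²b^{5/2}` and `0 ↔ 1`): `CeilingAt R ε₀ β` for
`β = kpTwoCycleTable c₀ c₁ ∘ σ`. [cite: Tao2016AveragedNS, §4 (4.13)] -/
theorem kpRelabel_twoCycleAsym_ceilingAt {c₀ c₁ ε₀ θ : ℝ} (hc₀ : 0 < c₀) (hc₁ : 0 < c₁) (hε : 0 < ε₀) (hε1 : ε₀ ≤ 1)
    (hθ : 1 / 2 < θ) (hθ10 : θ < 10) (hp : 42 / 25 ≤ (1 + ε₀) ^ ((5 : ℝ) / 2) / ((1 + ε₀) ^ θ) ^ 3)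
    (hwin₀ : ((1 + ε₀) ^ ((5 : ℝ) / 2) / ((1 + ε₀) ^ θ) ^ 3) ^ 2 * c₀ ^ 2 * (1 + ε₀) ^ θ ≤
      c₁ ^ 2 * (1 + ε₀) ^ ((5 : ℝ) / 2))
    (hwin₁ : ((1 + ε₀) ^ ((5 : ℝ) / 2) / ((1 + ε₀) ^ θ) ^ 3) ^ 2 * c₁ ^ 2 * (1 + ε₀) ^ θ ≤
      c₀ ^ 2 * (1 + ε₀) ^ ((5 : ℝ) / 2))
    (hβ : ∀ i₁ i₂ i₃ μ, β i₁ i₂ i₃ μ = kpTwoCycleTable c₀ c₁ (σ i₁) (σ i₂) (σ i₃) μ) (R : ℝ) :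
    CeilingAt R ε₀ β :=
  kpRelabel_ceilingAt σ hβ (kpTwoCycleAsym_ceilingAt hc₀ hc₁ hε hε1 hθ hθ10 hp hwin₀ hwin₁ R)

/-- **The side-branch class at any placement** (chain `c₀` on component `σ⁻¹ 0`, in-shell pump `P` from it into
`σ⁻¹ 1`, exit feed `f` from `σ⁻¹ 1` into the dead-end pocket `σ⁻¹ 2`; hypotheses = those of `sideClass_fwdCeilingKP`
read through `σ`), `1 + ε₀ ∈ [1.9, 2]`, certified weight range: the per-table body `FwdCeilingKPAt R ε₀ β` of the crux.
[cite: Tao2016AveragedNS, §4 (4.13)] [cite: BarbatoMorandinRomito2011, §3.2] -/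
theorem kpRelabel_sideClass_fwdCeilingKP (R : ℝ) {ε₀ c₀ P f κ : ℝ} (hε : 9 / 10 ≤ ε₀) (hε1 : ε₀ ≤ 1)
    (hw : ∀ a c : Fin 4, β a a c (0, 0, 1) =
      (if σ a = 0 ∧ σ c = 0 then c₀ else 0) + (if σ a = 1 ∧ σ c = 2 then f else 0))
    (hP : ∀ a c : Fin 4, a ≠ c → β a a c (0, 0, 0) = if σ a = 0 ∧ σ c = 1 then P else 0)
    (hCz : ∀ a b c : Fin 4, a ≠ b → a ≠ c → b ≠ c → β a b c (0, 0, 0) = 0)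
    (hc₀ : 0 < c₀) (hP0 : 0 ≤ P) (hf : 0 < f) (hκ : 0 < κ)
    (hpair : 13 * P ^ 2 < f ^ 2 * κ ^ 4)
    (hdrain : 5 * P * κ * (1 + ε₀) ^ ((5 : ℝ) / 2) ≤ c₀ * ((1 + ε₀) ^ ((101 : ℝ) / 200)) ^ 2)
    (hP1 : P * (1 + ε₀) ^ ((5 : ℝ) / 2) ≤ 2 * c₀ * ((1 + ε₀) ^ ((101 : ℝ) / 200)) ^ 2) :
    Literature.Analysis.FluidPDE.TaoCascade.InTableClass R β → (∀ (Y : Fin 4 → ℤ → ℝ → ℝ) (τ : ℝ), (∀ (j : Fin 4) (k : ℤ), 1 ≤ k → 0 ≤ Y j k τ) → ∀ δ : ℝ, 0 < δ → ∀ (i : Fin 4) (n : ℤ), 1 ≤ n → Y i n τ = 0 → 0 ≤ Literature.Analysis.FluidPDE.TaoCascade.quadTerm δ β Y i n τ) → (∀ a b i : Fin 4, a ≠ b → β a b i (0, 0, 1) = 0) → ∃ S : Finset (Fin 4), (∀ i, i ∉ S → ∀ j l : Fin 4, β i j l (0, 0, 1) = 0) ∧ ∃ θ : ℝ, 1 /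 2 < θ ∧ ∃ C : ℝ, 0 ≤ C ∧ ∀ ν : ℝ, 0 < ν → ∀ (X₀ : Fin 4 → ℝ) (s : ℝ), 0 < s → ∀ X : Fin 4 → ℤ → ℝ → ℝ, (∀ (i : Fin 4) (k : ℤ), X i k 0 = if k = 0 then X₀ i else 0) → (∀ (i : Fin 4) (k : ℤ), k < 0 → ∀ t : ℝ, X i k t = 0) → (∃ M : ℝ, ∀ (t : ℝ) (i : Fin 4) (k : ℤ), (1 + (1 + ε₀) ^ ((10 : ℝ) * k)) * |X i k t| ≤ M) → (∀ (i : Fin 4) (k : ℤ), Continuous (X i k)) → (∀ (i : Fin 4) (k : ℤ), ∀ t ∈ Set.Icc (0 : ℝ) s, HasDerivWithinAt (X i k) (Literature.Analysis.FluidPDE.TaoCascade.quadTerm ε₀ β X i k t - ν * (1 + ε₀) ^ ((2 : ℝ) * k) * X i k t) (Set.Icc (0 : ℝ) s) t) → (∀ t ∈ Set.Icc (0 : ℝ) s, ∀ (i : Fin 4) (k : ℤ), 1 ≤ k → 0 ≤ X i k t) → ∀ n N : ℕ, n ≤ N → ∀ t ∈ Set.Icc (0 : ℝ) s, ∑ k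 ∈ Finset.Icc n N, ∑ i ∈ S, (1 / 2 : ℝ) * X i (k : ℤ) t ^ 2 ≤ C * (∑ i : Fin 4, (1 / 2 : ℝ) * X₀ i ^ 2) * (1 + ε₀) ^ (-(2 * θ * (n : ℝ))) := by
  -- the table read through `σ⁻¹` is in the one-placement side-branch class
  set α : Fin 4 → Fin 4 → Fin 4 → ℤ × ℤ × ℤ → ℝ := fun i₁ i₂ i₃ μ => β (σ.symm i₁) (σ.symm i₂) (σ.symm i₃) μ
    with hα_def
  have hβ : ∀ i₁ i₂ i₃ μ, β i₁ i₂ i₃ μ = α (σ i₁) (σ i₂) (σ i₃) μ := by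
    intro i₁ i₂ i₃ μ
    simp only [hα_def, Equiv.symm_apply_apply]
  have hne : ∀ {a b : Fin 4}, a ≠ b → σ.symm a ≠ σ.symm b := fun h h' => h (σ.symm.injective h')
  have hw' : ∀ a c : Fin 4, α a a c (0, 0, 1) =
      (if a = 0 ∧ c = 0 then c₀ else 0) + (if a = 1 ∧ c = 2 then f else 0) := by
    intro a c
    simp only [hα_def, hw, Equiv.apply_symm_apply]
  have hP' : ∀ a c : Fin 4, a ≠ c → α a a c (0, 0, 0) = if a = 0 ∧ c = 1 then P else 0 := by
    intro a c hac
    simp only [hα_def, hP _ _ (hne hac), Equiv.apply_symm_apply]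
  have hCz' : ∀ a b c : Fin 4, a ≠ b → a ≠ c → b ≠ c → α a b c (0, 0, 0) = 0 := by
    intro a b c hab hac hbc
    simp only [hα_def]
    exact hCz _ _ _ (hne hab) (hne hac) (hne hbc)
  exact kpRelabel_fwdCeilingKPAt σ hβ
    (sideClass_fwdCeilingKP R hε hε1 hw' hP' hCz' hc₀ hP0 hf hκ hpair hdrain hP1)

end Summit.NavierStokesRegularity.NavierStokesRegularity.Theorems

end
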